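import Mathlib
import Literature.Analysis.FluidPDE.SpaceTimeCalculus
import Literature.Analysis.FluidPDE.SpaceTimeMixedPartials
import Literature.Analysis.FluidPDE.VorticityTransportFormulaProofs
import Summits.NavierStokesRegularity.NavierStokesRegularity.Theorems.TautLoopKelvinTautLoopLawStepFlowTaylorToolsAux
import HarnessLib

/-!
# Route `TautLoopKelvin`, crux `TautLoopLaw` (stmt-NavierStokesRegularity-15249), line
  `Sketch-ideas-r1k1` (Dini–Saks architecture) — tools stub `stub_tautLoopStepFlowTaylorTools`

Quantitative Taylor expansion in `τ = b - s` of a *given* jointly smooth backward flow `X` of a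
bounded smooth field `u` on a slab `[a, b] × E` (`b - a ≤ 1`): `∂ᵣ X(r, y) = u(r, X(r, y))`
within `[a, b]`, `X(b, ·) = id`, where `‖u‖ ≤ B₀`, `‖Du‖ ≤ B₁`, `‖D²u‖ ≤ B₂` and `u`, `Du` are
time-Lipschitz with constant `Bt`. With ONE constant `K = K(B₀, B₁, B₂, Bt)`, for `s ∈ [a, b]`:

1. `‖X(s, y) - y‖ ≤ K τ`;
2. `‖X(s, y) - (y - τ u(b, y))‖ ≤ K τ²`;
3. `‖DX(s)(y)‖ ≤ K`;
4. `‖DX(s)(y) - (id - τ Du(b)(y))‖ ≤ K τ²`;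
5. `‖D²X(s)(y)‖ ≤ K τ`.

Items 1–4 (mean value inequality along trajectories; the first variational equation
`J' = Du(r, X(r, y)) J`, the tree's `hasDerivWithinAt_fderiv_flow_apply`, and the linear Grönwall
inequality backward from `b`) are the auxiliary file `…StepFlowTaylorToolsAux`
(`stub_tautLoopFlowTAux`). This file adds item 5: the **second variational equation**
`M' = Du(r, X) M + D²u(r, X)[DX v, DX w]` for `M(r) = D(DX(r)(·) w)(y) v`, `M(b) = 0`, obtained
from the exchange of `∂ᵣ` and `D` for the jointly smooth field `(r, y) ↦ DX(r)(y) w` (the tree's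
`IsSmoothSpaceTimeOn.timeDerivWithin_fderiv_slice_apply_of_uniqueDiffOn`, valid on any time set of
unique differentiability) followed by the Leibniz and chain rules, and Grönwall backward from `b`
with the forcing `‖D²u(r, X)[DX v, DX w]‖ ≤ B₂ e^{2 B₁} ‖v‖ ‖w‖`; finally
`‖D²X(s)(y)‖ ≤ B₂ e^{3 B₁} τ` by the operator-norm bound, and the assembly of the registered
conjunction with `K = (1 + B₀ + (B₁ B₀ + Bt) + (B₁² + B₂ B₀ + Bt) + B₂) e^{3 B₁}`.

Everything is folklore ODE calculus (P. Hartman, *Ordinary Differential Equations* (1964), Ch. V,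
Thm. 3.1, Cor. 3.1 and Thm. 4.1: `C²` dependence on initial data and the higher variational
equations; the Grönwall inequality of Ch. III, Thm. 1.1).
-/

noncomputable section

open Set Function Filter Topology
open Literature.Analysis.FluidPDE

namespace Summit.NavierStokesRegularity.NavierStokesRegularity.Theorems

set_option linter.dupNamespace false

variable {E : Type*} [NormedAddCommGroup E] [NormedSpace ℝ E]

section Flow

variable {a b : ℝ} {u X : ℝ → E → E} {B₀ B₁ B₂ Bt : ℝ}

/-- **Second variational equation**: for fixed `y v w`, the second slice derivative
`M(r) = D(DX(r)(·) w)(y) v` has, within `[a, b]`, the derivative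
`Du(s, X(s, y)) M(s) + D²u(s, X(s, y))[DX(s)(y) v, DX(s)(y) w]`: exchange of `∂ᵣ` and `D` for the
jointly smooth field `(r, y) ↦ DX(r)(y) w`, whose time derivative is `Du(r, X(r, y)) DX(r)(y) w` by
the first variational equation, followed by the Leibniz and chain rules. [folklore] -/
theorem tautLoopFlowT_hasDerivWithinAt_fderiv₂ [CompleteSpace E] (hab : a < b)
    (hu : IsSmoothSpaceTimeOn (Icc a b) u) (hX : IsSmoothSpaceTimeOn (Icc a b) X)
    (hXu : ∀ s ∈ Icc a b, ∀ y, HasDerivWithinAt (fun r => X r y) (u s (X s y)) (Icc a b) s)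
    {s : ℝ} (hs : s ∈ Icc a b) (y v w : E) :
    HasDerivWithinAt (fun r => fderiv ℝ (fun y' => fderiv ℝ (X r) y' w) y v)
      (fderiv ℝ (u s) (X s y) (fderiv ℝ (fun y' => fderiv ℝ (X s) y' w) y v) +
        fderiv ℝ (fderiv ℝ (u s)) (X s y) (fderiv ℝ (X s) y v) (fderiv ℝ (X s) y w))
      (Icc a b) s := by
  have hU : UniqueDiffOn ℝ (Icc a b) := uniqueDiffOn_Icc hab
  -- the jointly smooth field `(r, y') ↦ DX(r)(y') w` and its time derivative within `[a, b]`
  have hXw : IsSmoothSpaceTimeOn (Icc a b) (fun r y' => fderiv ℝ (X r) y' w) :=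
    hX.fderiv_slice_apply hU w
  have hXw_t : timeDerivWithin (Icc a b) (fun r y' => fderiv ℝ (X r) y' w) s =
      fun y' => fderiv ℝ (u s) (X s y') (fderiv ℝ (X s) y' w) := by
    funext y'
    rw [timeDerivWithin_apply]
    exact (hasDerivWithinAt_fderiv_flow_apply hu hX hU hXu hs y' w).derivWithin (hU s hs)
  -- the field `(r, y') ↦ D(DX(r)(·) w)(y') v`; exchange of `∂ᵣ` and `D`
  have hM : IsSmoothSpaceTimeOn (Icc a b)
      (fun r y' => fderiv ℝ (fun y'' => fderiv ℝ (X r) y'' w) y' v) :=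
    hXw.fderiv_slice_apply hU v
  have h1 := hM.hasDerivWithinAt_timeDerivWithin hU hs y
  rw [hXw.timeDerivWithin_fderiv_slice_apply_of_uniqueDiffOn hU hs y v, hXw_t] at h1
  -- the spatial derivative of `y' ↦ Du(s)(X s y') (DX(s)(y') w)`
  have hu2 : ContDiff ℝ 2 (u s) := (hu.contDiff_slice hs).of_le (by norm_cast)
  have hc : HasFDerivAt (fun y' => fderiv ℝ (u s) (X s y'))
      ((fderiv ℝ (fderiv ℝ (u s)) (X s y)).comp (fderiv ℝ (X s) y)) y := by
    have hd2 : HasFDerivAt (fderiv ℝ (u s)) (fderiv ℝ (fderiv ℝ (u s)) (X s y)) (X s y) :=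
      ((hu2.fderiv_right (m := 1) (by norm_num)).differentiable one_ne_zero (X s y)).hasFDerivAt
    have hXa : HasFDerivAt (X s) (fderiv ℝ (X s) y) y :=
      (((hX.contDiff_slice hs).differentiable (by simp)) y).hasFDerivAt
    exact hd2.comp y hXa
  have hd : HasFDerivAt (fun y' => fderiv ℝ (X s) y' w)
      (fderiv ℝ (fun y' => fderiv ℝ (X s) y' w) y) y :=
    (((hXw.contDiff_slice hs).differentiable (by simp)) y).hasFDerivAt
  refine h1.congr_deriv ?_
  rw [(hc.clm_apply hd).fderiv]
  simp only [add_apply, ContinuousLinearMap.comp_apply, ContinuousLinearMap.flip_apply]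

/-- **Second variation bound**: `‖D(DX(s)(·) w)(y) v‖ ≤ B₂ e^{3 B₁} (b - s) ‖v‖ ‖w‖` — Grönwall
backward from `b` for the second variational equation (forcing
`‖D²u(r, X)[DX v, DX w]‖ ≤ B₂ e^{2 B₁} ‖v‖ ‖w‖`), where the second variation vanishes at `r = b`
since `X(b, ·) = id`. [folklore] -/
theorem tautLoopFlowT_fderiv₂_apply_le [CompleteSpace E] (hab : a < b) (hba : b - a ≤ 1)
    (hu : IsSmoothSpaceTimeOn (Icc a b) u) (hX : IsSmoothSpaceTimeOn (Icc a b) X)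
    (hXu : ∀ s ∈ Icc a b, ∀ y, HasDerivWithinAt (fun r => X r y) (u s (X s y)) (Icc a b) s)
    (hXb : ∀ y, X b y = y) (hB₁ : ∀ s ∈ Icc a b, ∀ x, ‖fderiv ℝ (u s) x‖ ≤ B₁)
    (hB₂ : ∀ s ∈ Icc a b, ∀ x, ‖iteratedFDeriv ℝ 2 (u s) x‖ ≤ B₂) (h₁ : 0 ≤ B₁) (h₂ : 0 ≤ B₂)
    {s : ℝ} (hs : s ∈ Icc a b) (y v w : E) :
    ‖fderiv ℝ (fun y' => fderiv ℝ (X s) y' w) y v‖ ≤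
      B₂ * Real.exp (3 * B₁) * (b - s) * ‖v‖ * ‖w‖ := by
  have hsub : Icc s b ⊆ Icc a b := Icc_subset_Icc hs.1 le_rfl
  have hτ0 : 0 ≤ b - s := sub_nonneg.2 hs.2
  have hτ1 : b - s ≤ 1 := by linarith [hs.1]
  -- a priori bound of the first variation on `[s, b]`
  have hJ : ∀ r ∈ Icc s b, ∀ z : E, ‖fderiv ℝ (X r) y z‖ ≤ Real.exp B₁ * ‖z‖ := by
    intro r hr z
    refine (tautLoopFlowT_fderiv_apply_le hab hu hX hXu hXb hB₁ h₁ (hsub hr) y z).trans ?_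
    gcongr
    exact mul_le_of_le_one_right h₁ (by linarith [hr.1, hs.1])
  have hder := fun r (hr : r ∈ Icc s b) =>
    (tautLoopFlowT_hasDerivWithinAt_fderiv₂ hab hu hX hXu (hsub hr) y v w).mono hsub
  have hbd : ∀ r ∈ Icc s b,
      ‖fderiv ℝ (u r) (X r y) (fderiv ℝ (fun y' => fderiv ℝ (X r) y' w) y v) +
          fderiv ℝ (fderiv ℝ (u r)) (X r y) (fderiv ℝ (X r) y v) (fderiv ℝ (X r) y w)‖ ≤
        B₁ * ‖fderiv ℝ (fun y' => fderiv ℝ (X r) y' w) y v‖ +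
          B₂ * (Real.exp B₁ * ‖v‖) * (Real.exp B₁ * ‖w‖) := by
    intro r hr
    have hr' := hsub hr
    refine (norm_add_le _ _).trans (add_le_add ?_ ?_)
    · exact (fderiv ℝ (u r) (X r y)).le_of_opNorm_le (hB₁ r hr' _) _
    · refine ((fderiv ℝ (fderiv ℝ (u r)) (X r y)).le_opNorm₂ _ _).trans ?_
      have e : ‖fderiv ℝ (fderiv ℝ (u r)) (X r y)‖ ≤ B₂ := by
        rw [← norm_iteratedFDeriv_one (𝕜 := ℝ) (fderiv ℝ (u r)), norm_iteratedFDeriv_fderiv]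
        exact hB₂ r hr' _
      have ev := hJ r hr v
      have ew := hJ r hr w
      gcongr
  have h := tautLoopFlowT_gronwall_back hs.2 hder hbd h₁ (by positivity)
  -- at `r = b` the second variation vanishes
  have hXb' : X b = id := funext hXb
  have e0 : fderiv ℝ (fun y' => fderiv ℝ (X b) y' w) y v = 0 := by
    have : (fun y' => fderiv ℝ (X b) y' w) = fun _ => w := by
      funext y'
      simp [hXb']
    rw [this]
    simp
  rw [e0, norm_zero, zero_add] at h
  calc ‖fderiv ℝ (fun y' => fderiv ℝ (X s) y' w) y v‖
      ≤ B₂ * (Real.exp B₁ * ‖v‖) * (Real.exp B₁ * ‖w‖) * (b - s) * Real.exp (B₁ * (b - s)) := h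
    _ ≤ B₂ * (Real.exp B₁ * ‖v‖) * (Real.exp B₁ * ‖w‖) * (b - s) * Real.exp B₁ := by
      gcongr; exact mul_le_of_le_one_right h₁ hτ1
    _ = B₂ * (Real.exp B₁ * Real.exp B₁ * Real.exp B₁) * (b - s) * ‖v‖ * ‖w‖ := by ring
    _ = B₂ * Real.exp (3 * B₁) * (b - s) * ‖v‖ * ‖w‖ := by
      rw [show (3 : ℝ) * B₁ = B₁ + B₁ + B₁ by ring, Real.exp_add, Real.exp_add]

/-- **Second derivative of the flow map**: `‖D²X(s)(y)‖ ≤ B₂ e^{3 B₁} (b - s)`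
(`D²X(s)(y)[v, w] = D(DX(s)(·) w)(y) v` and the operator-norm bound). [folklore] -/
theorem tautLoopFlowT_iteratedFDeriv_two_le [CompleteSpace E] (hab : a < b) (hba : b - a ≤ 1)
    (hu : IsSmoothSpaceTimeOn (Icc a b) u) (hX : IsSmoothSpaceTimeOn (Icc a b) X)
    (hXu : ∀ s ∈ Icc a b, ∀ y, HasDerivWithinAt (fun r => X r y) (u s (X s y)) (Icc a b) s)
    (hXb : ∀ y, X b y = y) (hB₁ : ∀ s ∈ Icc a b, ∀ x, ‖fderiv ℝ (u s) x‖ ≤ B₁)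
    (hB₂ : ∀ s ∈ Icc a b, ∀ x, ‖iteratedFDeriv ℝ 2 (u s) x‖ ≤ B₂) (h₁ : 0 ≤ B₁) (h₂ : 0 ≤ B₂)
    {s : ℝ} (hs : s ∈ Icc a b) (y : E) :
    ‖iteratedFDeriv ℝ 2 (X s) y‖ ≤ B₂ * Real.exp (3 * B₁) * (b - s) := by
  have hτ0 : 0 ≤ b - s := sub_nonneg.2 hs.2
  refine ContinuousMultilinearMap.opNorm_le_bound (by positivity) fun m => ?_
  rw [iteratedFDeriv_two_apply, Fin.prod_univ_two]
  have hX2 : ContDiff ℝ 2 (X s) := (hX.contDiff_slice hs).of_le (by norm_cast)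
  have hXd : DifferentiableAt ℝ (fderiv ℝ (X s)) y :=
    ((hX2.fderiv_right (m := 1) (by norm_num)).differentiable one_ne_zero) y
  have e : fderiv ℝ (fderiv ℝ (X s)) y (m 0) (m 1) =
      fderiv ℝ (fun y' => fderiv ℝ (X s) y' (m 1)) y (m 0) := by
    rw [fderiv_clm_apply hXd (differentiableAt_const _)]
    simp
  rw [e]
  calc ‖fderiv ℝ (fun y' => fderiv ℝ (X s) y' (m 1)) y (m 0)‖
      ≤ B₂ * Real.exp (3 * B₁) * (b - s) * ‖m 0‖ * ‖m 1‖ :=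
        tautLoopFlowT_fderiv₂_apply_le hab hba hu hX hXu hXb hB₁ hB₂ h₁ h₂ hs y (m 0) (m 1)
    _ = B₂ * Real.exp (3 * B₁) * (b - s) * (‖m 0‖ * ‖m 1‖) := by ring

end Flow

/-! ### The registered tools stub -/

/-- **Tools stub `stub_tautLoopStepFlowTaylorTools`** (quantitative Taylor estimates in
`τ = b - s` for a given jointly smooth backward flow `X` of a bounded smooth field `u` on a slab of
length `≤ 1`): one constant `K = K(B₀, B₁, B₂, Bt)` controls the displacement (`K τ`), its
second-order expansion `X(s, y) = y - τ u(b, y) + O(K τ²)`, the first variation (`‖DX‖ ≤ K`,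
`DX(s)(y) = id - τ Du(b)(y) + O(K τ²)`) and the second variation (`‖D²X(s)(y)‖ ≤ K τ`). Assembly
of `tautLoopFlowT_disp`, `tautLoopFlowT_disp₂`, `tautLoopFlowT_fderiv_apply_le`,
`tautLoopFlowT_fderiv_taylor`, `tautLoopFlowT_iteratedFDeriv_two_le` with
`K = (1 + B₀ + (B₁ B₀ + Bt) + (B₁² + B₂ B₀ + Bt) + B₂) e^{3 B₁}`. [folklore] -/
theorem stub_tautLoopStepFlowTaylorTools : ∀ (B₀ B₁ B₂ Bt : ℝ), 0 ≤ B₀ → 0 ≤ B₁ → 0 ≤ B₂ →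
    0 ≤ Bt → ∃ K : ℝ, 0 ≤ K ∧ ∀ (u X : ℝ → EuclideanSpace ℝ (Fin 3) → EuclideanSpace ℝ (Fin 3))
    (a b : ℝ), a < b → b - a ≤ 1 → Literature.Analysis.FluidPDE.IsSmoothSpaceTimeOn (Set.Icc a b) u →
    Literature.Analysis.FluidPDE.IsSmoothSpaceTimeOn (Set.Icc a b) X →
    (∀ s ∈ Set.Icc a b, ∀ y, HasDerivWithinAt (fun r => X r y) (u s (X s y)) (Set.Icc a b) s) →
    (∀ y, X b y = y) → (∀ s ∈ Set.Icc a b, ∀ x, ‖u s x‖ ≤ B₀) →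
    (∀ s ∈ Set.Icc a b, ∀ x, ‖fderiv ℝ (u s) x‖ ≤ B₁) →
    (∀ s ∈ Set.Icc a b, ∀ x, ‖iteratedFDeriv ℝ 2 (u s) x‖ ≤ B₂) →
    (∀ s ∈ Set.Icc a b, ∀ s' ∈ Set.Icc a b, ∀ x, ‖u s' x - u s x‖ ≤ Bt * |s' - s|) →
    (∀ s ∈ Set.Icc a b, ∀ s' ∈ Set.Icc a b, ∀ x,
      ‖fderiv ℝ (u s') x - fderiv ℝ (u s) x‖ ≤ Bt * |s' - s|) →
    ∀ s ∈ Set.Icc a b, (∀ y, ‖X s y - y‖ ≤ K * (b - s)) ∧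
    (∀ y, ‖X s y - (y - (b - s) • u b y)‖ ≤ K * (b - s) ^ 2) ∧ (∀ y, ‖fderiv ℝ (X s) y‖ ≤ K) ∧
    (∀ y, ‖fderiv ℝ (X s) y - (ContinuousLinearMap.id ℝ (EuclideanSpace ℝ (Fin 3)) -
      (b - s) • fderiv ℝ (u b) y)‖ ≤ K * (b - s) ^ 2) ∧
    (∀ y, ‖iteratedFDeriv ℝ 2 (X s) y‖ ≤ K * (b - s)) := by
  intro B₀ B₁ B₂ Bt hB₀ hB₁ hB₂ hBt
  -- the constant
  set S : ℝ := 1 + B₀ + (B₁ * B₀ + Bt) + (B₁ ^ 2 + B₂ * B₀ + Bt) + B₂ with hS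
  have hS1 : 1 ≤ S := by
    have := mul_nonneg hB₁ hB₀
    have := mul_nonneg hB₂ hB₀
    have := sq_nonneg B₁
    linarith
  have hS0 : 0 ≤ S := zero_le_one.trans hS1
  have hE1 : 1 ≤ Real.exp (3 * B₁) := Real.one_le_exp (by positivity)
  have hE3 : Real.exp B₁ ≤ Real.exp (3 * B₁) := Real.exp_le_exp.2 (by linarith)
  have hSK : S ≤ S * Real.exp (3 * B₁) := le_mul_of_one_le_right hS0 hE1
  have hEK : Real.exp (3 * B₁) ≤ S * Real.exp (3 * B₁) :=
    le_mul_of_one_le_left (Real.exp_pos _).le hS1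
  refine ⟨S * Real.exp (3 * B₁), by positivity, ?_⟩
  intro u X a b hab hba hu hX hXu hXb hu0 hu1 hu2 hut hDut s hs
  have hτ0 : 0 ≤ b - s := sub_nonneg.2 hs.2
  have hτ1 : b - s ≤ 1 := by linarith [hs.1]
  refine ⟨fun y => ?_, fun y => ?_, fun y => ?_, fun y => ?_, fun y => ?_⟩
  · -- (1) displacement
    calc ‖X s y - y‖ ≤ B₀ * (b - s) := tautLoopFlowT_disp hXu hXb hu0 hs y
      _ ≤ S * Real.exp (3 * B₁) * (b - s) := by
        gcongr
        exact le_trans (by linarith [mul_nonneg hB₁ hB₀, mul_nonneg hB₂ hB₀, sq_nonneg B₁]) hSK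
  · -- (2) displacement to second order
    calc ‖X s y - (y - (b - s) • u b y)‖ ≤ (B₁ * B₀ + Bt) * (b - s) ^ 2 :=
          tautLoopFlowT_disp₂ hu hXu hXb hu0 hu1 hut hB₀ hB₁ hBt hs y
      _ ≤ S * Real.exp (3 * B₁) * (b - s) ^ 2 := by
        gcongr
        exact le_trans (by linarith [mul_nonneg hB₂ hB₀, sq_nonneg B₁]) hSK
  · -- (3) first variation
    refine ContinuousLinearMap.opNorm_le_bound _ (by positivity) fun w => ?_
    calc ‖fderiv ℝ (X s) y w‖ ≤ Real.exp (B₁ * (b - s)) * ‖w‖ :=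
          tautLoopFlowT_fderiv_apply_le hab hu hX hXu hXb hu1 hB₁ hs y w
      _ ≤ S * Real.exp (3 * B₁) * ‖w‖ := by
        gcongr
        exact (Real.exp_le_exp.2 (by nlinarith)).trans hEK
  · -- (4) first variation to second order
    refine ContinuousLinearMap.opNorm_le_bound _ (by positivity) fun w => ?_
    have e : (fderiv ℝ (X s) y - (ContinuousLinearMap.id ℝ (EuclideanSpace ℝ (Fin 3)) -
        (b - s) • fderiv ℝ (u b) y)) w =
        fderiv ℝ (X s) y w - w + (b - s) • fderiv ℝ (u b) y w := by
      simp only [sub_apply, smul_apply, ContinuousLinearMap.coe_id', id_eq]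
      abel
    rw [e]
    calc ‖fderiv ℝ (X s) y w - w + (b - s) • fderiv ℝ (u b) y w‖
        ≤ (B₁ ^ 2 + B₂ * B₀ + Bt) * Real.exp B₁ * (b - s) ^ 2 * ‖w‖ :=
          tautLoopFlowT_fderiv_taylor hab hba hu hX hXu hXb hu0 hu1 hu2 hDut hB₀ hB₁ hB₂ hBt hs y w
      _ ≤ S * Real.exp (3 * B₁) * (b - s) ^ 2 * ‖w‖ := by
        gcongr
        · linarith [mul_nonneg hB₁ hB₀]
  · -- (5) second variation
    calc ‖iteratedFDeriv ℝ 2 (X s) y‖ ≤ B₂ * Real.exp (3 * B₁) * (b - s) :=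
          tautLoopFlowT_iteratedFDeriv_two_le hab hba hu hX hXu hXb hu1 hu2 hB₁ hB₂ hs y
      _ ≤ S * Real.exp (3 * B₁) * (b - s) := by
        gcongr
        linarith [mul_nonneg hB₁ hB₀, mul_nonneg hB₂ hB₀, sq_nonneg B₁]

end Summit.NavierStokesRegularity.NavierStokesRegularity.Theorems

end
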